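import Summits.QuantumFields.BalabanUV.T4Continuum.Support.NE9ProjectionCostBudget
import Summits.QuantumFields.BalabanUV.T4Continuum.Support.NE9FadingArithmeticHolder

/-!
# NE9ProjectionCostBudgetRate — the PROJECTION-COST BUDGET (PCB) AT THE RATE LETTER `ω = L^{−β}` (cell `pub-balaban`, T4-DAG
§2 node U3 / §6 NE9; rung (B)+1 on a FIXED finite T⁴; NE9 formalisation crew, unit `b2b-balaban-t4-ne9-formalise-leaf-04` gen 4 —
the lineage's own amendment of `NE9ProjectionCostBudget` (gen 2, p209653) under the row owner's located correction O-ne9p1g23-1 /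
referee pass 4 DV-10; nothing of PCB, of (w6) `NE9FadingArithmetic` or of the (w6) AMENDMENT `NE9FadingArithmeticHolder` is modified
or restated — their lemmas are consumed BY NAME)

HONEST FRAMING (T4-DAG PAGE 1).  Rung (B)+1 = existence and uniqueness of the ε → 0 limit of gauge-invariant observables on a
FIXED finite torus T⁴ — NOT infinite volume, NOT a mass gap, NOT the Clay problem.  NE9 is a cell NEW ESTIMATE, NOT PRINTED, NOT
proved here; leaf N2 stays a DISPLAYED binder (trigger c3).  This file is REAL ARITHMETIC on displayed hypothesis SHAPES: p. 20
«(LM)⁴α₄ … bounded … by 1» as `(L·M)⁴·α₄ ≤ 1`, p. 21 «O(1)C₃ε₁ ≤ ½E₀» as `B ≤ E₀/2`, p. 18's κ-assumption as a κ-CLAUSE, and row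
AW's `a ≤ c_A·M⁴` (NOT PRINTED — the cell's model-level bound of PCB §1).  Every inequality concluded is OURS, not print's;
`FlowStep.BetaPertH`, (B), (B^μ) do not occur.  HONEST DEPENDENCY (verbatim): continuum YM on T⁴ ⇐ BetaPertH ∧ nine spine estimates
(0/9 proved); BetaPertH ⇐ (D1) ∧ (D4) ∧ CAP+tail; G-an2-4 gates asym, D1 and NE2/3/4.

WHY.  PCB §2 hard-codes the contraction letter `ω = 1/L` in every statement (`room_AW_iff`, (V1) `not_rescued_by_M`,
`fade_of_printed_AW`, `fade_of_budget_AW`, (V2) `fade_of_p18_AW`) and its census (C† = 1/5616, κ_min = 5 at the displayed corner).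
The owner's FINDING F-ne9p1g23-1 (journal l.7710; GAPS O-ne9p1g23-1; referee pass 4 DV-10, renders [I] p. 285 (4.18), p. 288
re-read there) fixes the letter: for the (4.30)-remainder species the per-creation-step gain is `(L^jη)^{4+β}` with the Hölder
exponent `0 < β ≤ β₀ < 1` of [I] (3.32)/(4.18), so **`ω = L^{−β}`, not `L⁻¹`** ([I] (0.29)–(0.30) p. 258).  Statements at `1/L`
stay TRUE but are the WRONG INSTANCE.  The (w6) AMENDMENT (`NE9FadingArithmeticHolder`, p211550) restates leaf-10's threshold at
`L^{−β}`, parametric in `K` (so the (w10) rider `K_eff = K(1 + cr·a)` is covered) — but NOT PCB's AW-shape corollaries, where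
`a ≤ c_A·M⁴` puts `M⁴` INSIDE the projection cost.  THIS FILE restates PCB §2 at a rate LETTER `ω` and at `ω := L^{−β}`.

WHAT IS PROVED (kernel; 0 `def`, 0 sorry).
§1 RATE-LETTER FORMS (ω any real letter): `room_AW_iff_rate`; **`not_rescued_by_M_rate`** (the room with the projection cost
   forces the M-FREE bound `648·K·c₁c₂·cr·c_A < 1 − ω`); `no_M_of_rate_le` (if `1 − ω ≤ 648Kc₁c₂·cr·c_A`, NO `M > 0` satisfies
   the room); `fade_of_printed_AW_rate`, `fade_of_budget_AW_rate`, **`fade_of_p18_AW_rate`** (κ-clause `… e^{−5κ} < (1 − ω)·E₀`);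
   `room_rate_anti` / `kappaClause_rate_anti` (a SMALLER letter only helps); PCB's §2 is the instance `ω = 1/L` (examples).
§2 THE HÖLDER INSTANCE `ω := L^{−β}`: `gap_le_gap_one` (`β ≤ 1 ⇒ 1 − L^{−β} ≤ 1 − 1/L`: every PCB threshold at `1/L` is NECESSARY,
   not sufficient, at the Hölder letter); `not_rescued_by_M_rpow` (+ `_inv`: it implies PCB's (V1)); `room_lt_exponent_mul_log`
   (a room at `L^{−β}` forces `648Kc₁c₂·cr·c_A < β·log L`); **`exists_exponent_no_M`** — for ANY positive projection cost there is an
   exponent `β > 0` (explicitly `648Kc₁c₂·cr·c_A / log L`) at and below which NO `M` rescues: with the projection cost the Hölder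
   exponent acquires a FLOOR `β†`, `1 − L^{−β†} = 648Kc₁c₂·cr·c_A` (contrast: for (w6)'s M-only clause small β merely pushes `M`
   up — `NE9FadingArithmeticHolder.room_not_uniform`); `fade_of_p18_AW_rpow` and its UNIFORM form `_of_le` on a declared range
   `β₁ ≤ β` (clause at `β₁` suffices).
§3 NUMERIC CORNERS at `L = M = 13`, `K = 8`, `β = 1/4` (SMALLNESS §4's ceiling), via `rpow13_neg_quarter_bounds` BY NAME
   (`10/19 < 13^{−1/4} < 100/189`): (V1) ceiling `89/979776 < (1 − 13^{−1/4})/5184 < 9/98496` (≈ 9.1·10⁻⁵: between 0.50 and 0.52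
   of the β = 1 value `1/5616`); the cost `cr·c_A = 10⁻⁴` (with `c₁c₂ = 1`) is ADMISSIBLE at `ω = 1/13` (`M = 13` satisfies the
   room) but admits NO `M` at `ω = 13^{−1/4}`; (V2) κ-corner (`c⋆⋆ = E₀ = cr·c_A = 1`): `e^{20}·(9/19) < T″ := 2592·8·15⁴·(13⁻⁴ + 1)
   < e^{25}·(89/189)` ⇒ **κ_min = 5 at β = 1/4 exactly as at β = 1** — the p. 18/«κ large» route is insensitive to the letter
   change at the displayed corner, the «M large» route's obstruction tightens.  Census: `HOME/t4/b2b-balaban-t4-ne9-formalise-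
   leaf-04/NE9ProjectionCostCensus.md` v2 §6 (two kit engines, exact rationals, byte-identical stdout).

References (TYPE locators only; nothing printed is a hypothesis-free assertion): T. Bałaban, CMP **109** (1987) [Balaban1987RG1]
p. 251 («L … > 11»), (0.29)–(0.30) p. 258, Thm 3 p. 264, (4.18) p. 285, p. 288; CMP **116** (1988) [Balaban1988RG2Cluster]
p. 8 l. 9–10, (1.36) p. 9, (2.18)–(2.20) p. 16, p. 18 text, p. 20 text, (2.41) and p. 21 text.
-/

noncomputable section

namespace Summit.QuantumFields.BalabanUV.T4Continuum.NE9ProjectionCostBudgetRate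

open Summit.QuantumFields.BalabanUV.T4Continuum.NE9ProjectionCostBudget
open Summit.QuantumFields.BalabanUV.T4Continuum.NE9FadingArithmeticHolder

/-! ## §1 PCB §2 at a rate LETTER `ω` -/

section Rate

/-- The room clause with the projection cost under the AW shape, divided by `M⁴ > 0`, at ANY rate letter:
`648Kc₁c₂(1 + cr·c_A·M⁴) < (1 − ω)M⁴ ↔ 648Kc₁c₂(1/M⁴ + cr·c_A) < 1 − ω` (PCB `room_AW_iff` is `ω = 1/L`). [folklore] -/
theorem room_AW_iff_rate {ω K M c₁ c₂ cr c_A : ℝ} (hM : 0 < M) :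
    648 * K * (c₁ * c₂) * (1 + cr * c_A * M ^ 4) < (1 - ω) * M ^ 4 ↔
      648 * K * (c₁ * c₂) * (1 / M ^ 4 + cr * c_A) < 1 - ω := by
  have hM4 : 0 < M ^ 4 := by positivity
  have hM0 : M ^ 4 ≠ 0 := hM4.ne'
  have e : 648 * K * (c₁ * c₂) * (1 + cr * c_A * M ^ 4) = 648 * K * (c₁ * c₂) * (1 / M ^ 4 + cr * c_A) * M ^ 4 := by
    field_simp
  rw [e, mul_lt_mul_iff_left₀ hM4]

/-- **(V1) AT ANY RATE LETTER: «M SUFFICIENTLY LARGE» DOES NOT YIELD FADING.**  The room clause with the projection cost under the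
AW shape IMPLIES the M-FREE necessary condition `648·K·c₁c₂·cr·c_A < 1 − ω` (the addend `648Kc₁c₂/M⁴` is nonnegative).  PCB's
`not_rescued_by_M` is the instance `ω = 1/L`.  Real arithmetic; nothing printed asserted. [folklore] -/
theorem not_rescued_by_M_rate {ω K M c₁ c₂ cr c_A : ℝ} (hK : 0 ≤ K) (hM : 0 < M) (hc₁ : 0 ≤ c₁) (hc₂ : 0 ≤ c₂)
    (hroom : 648 * K * (c₁ * c₂) * (1 + cr * c_A * M ^ 4) < (1 - ω) * M ^ 4) :
    648 * K * (c₁ * c₂) * (cr * c_A) < 1 - ω := by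
  have h := (room_AW_iff_rate (K := K) (c₁ := c₁) (c₂ := c₂) (cr := cr) (c_A := c_A) (ω := ω) hM).1 hroom
  have h0 : 0 ≤ 648 * K * (c₁ * c₂) * (1 / M ^ 4) := by positivity
  nlinarith [h, h0]

/-- **NO `M` AT ALL once the letter's gap is spent on the projection cost**: if `1 − ω ≤ 648·K·c₁c₂·cr·c_A`, the room clause fails
for EVERY `M > 0` (contrapositive of `not_rescued_by_M_rate`). [folklore] -/
theorem no_M_of_rate_le {ω K c₁ c₂ cr c_A : ℝ} (hK : 0 ≤ K) (hc₁ : 0 ≤ c₁) (hc₂ : 0 ≤ c₂)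
    (hle : 1 - ω ≤ 648 * K * (c₁ * c₂) * (cr * c_A)) :
    ∀ M : ℝ, 0 < M → ¬ (648 * K * (c₁ * c₂) * (1 + cr * c_A * M ^ 4) < (1 - ω) * M ^ 4) :=
  fun _ hM hroom => absurd (not_rescued_by_M_rate hK hM hc₁ hc₂ hroom) (not_lt.mpr hle)

/-- **FADING FROM p. 20/p. 21 UNDER THE AW ROOM, AT ANY RATE LETTER** (PCB `rateGap_le_of_printed_AW` BY NAME): the located gap
`K·lipbar·B·((1 + cr·a)·τ̄) ≤ 648·K·c₁c₂·(1/M⁴ + cr·c_A)` and the room `648Kc₁c₂(1/M⁴ + cr·c_A) < 1 − ω` give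
`ω + K·lipbar·B·((1 + cr·a)·τ̄) < 1` — for `K = 8` the rate letter `ω′ = ω + 8·lipbar·B·((1 + c)·τ̄)` of
`NE9MarginalProjectionEnd`, `c = cr·a`.  Hypothesis SHAPES of p. 20 / p. 21 / row AW only.
[cite: Balaban1988RG2Cluster, p.20, p.21, (1.36) p.9, (2.18)-(2.20) p.16] -/
theorem fade_of_printed_AW_rate {ω K L M α₄ E₀ B c₁ c₂ cr a c_A : ℝ} (hK : 0 ≤ K) (hM : 0 < M) (hE : 0 < E₀)
    (hB : 0 ≤ B) (hc₁ : 0 ≤ c₁) (hc₂ : 0 ≤ c₂) (hα₄ : 0 ≤ α₄) (h20 : (L * M) ^ 4 * α₄ ≤ 1) (h21 : B ≤ E₀ / 2)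
    (hcr : 0 ≤ cr) (hcA : 0 ≤ c_A) (ha : a ≤ c_A * M ^ 4)
    (hroom : 648 * K * (c₁ * c₂) * (1 / M ^ 4 + cr * c_A) < 1 - ω) :
    ω + K * (c₁ * α₄ / E₀) * B * ((1 + cr * a) * (c₂ * (6 * L) ^ 4)) < 1 := by
  have h := rateGap_le_of_printed_AW hK hM hE hB hc₁ hc₂ hα₄ h20 h21 hcr hcA ha
  linarith

/-- **(V2) FADING FROM THE BUDGET's SMALLNESS, AT ANY RATE LETTER** (PCB `rateGap_le_budget_AW` BY NAME; p. 21's own TYPE «we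
can take E₀ such, that the assumption is satisfied» with a definite constant carrying the projection cost):
`B/E₀ < (1 − ω)/(1296Kc₁c₂(1/M⁴ + cr·c_A))` ⇒ `ω + K·lipbar·B·((1 + cr·a)·τ̄) < 1`. [cite: Balaban1988RG2Cluster, p.20, p.21] -/
theorem fade_of_budget_AW_rate {ω K L M α₄ E₀ B c₁ c₂ cr a c_A : ℝ} (hK : 0 ≤ K) (hM : 0 < M) (hE : 0 < E₀) (hB : 0 ≤ B)
    (hc₁ : 0 ≤ c₁) (hc₂ : 0 ≤ c₂) (hα₄ : 0 ≤ α₄) (h20 : (L * M) ^ 4 * α₄ ≤ 1) (hcr : 0 ≤ cr) (hcA : 0 ≤ c_A)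
    (ha : a ≤ c_A * M ^ 4) (hX : 0 < 1296 * K * (c₁ * c₂) * (1 / M ^ 4 + cr * c_A))
    (hsmall : B / E₀ < (1 - ω) / (1296 * K * (c₁ * c₂) * (1 / M ^ 4 + cr * c_A))) :
    ω + K * (c₁ * α₄ / E₀) * B * ((1 + cr * a) * (c₂ * (6 * L) ^ 4)) < 1 := by
  have h := rateGap_le_budget_AW hK hM hE hB hc₁ hc₂ hα₄ h20 hcr hcA ha
  rw [lt_div_iff₀ hX] at hsmall
  nlinarith [h, hsmall]

/-- **(V2) FADING FROM p. 20 + p. 18 + «κ LARGE», AT ANY RATE LETTER** — PCB `fade_of_p18_AW` with `1 − 1/L ↦ 1 − ω` in the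
κ-CLAUSE `2592·K·c₁c₂·c′·c_B·(L+2)⁴·(1/M⁴ + cr·c_A)·e^{−5κ} < (1 − ω)·E₀` (p. 18 «Assuming 2E₀ε₁C₁α₄⁻¹α₆⁻¹M^q exp C₂κ₁ exp 5κ ≤ 1»
as the SHAPE `C₃ε₁ ≤ 2(L+2)⁴·c′·e^{−5κ}`, `B = c_B·C₃ε₁`).  Hypothesis shapes only. [cite: Balaban1988RG2Cluster, p.18, p.20, (2.41) p.21] -/
theorem fade_of_p18_AW_rate {ω K L M α₄ E₀ B c₁ c₂ cr a c_A c_B c' C3e κ : ℝ} (hK : 0 ≤ K) (hM : 0 < M) (hE : 0 < E₀)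
    (hc₁ : 0 ≤ c₁) (hc₂ : 0 ≤ c₂) (hα₄ : 0 ≤ α₄) (h20 : (L * M) ^ 4 * α₄ ≤ 1) (hcr : 0 ≤ cr) (hcA : 0 ≤ c_A)
    (ha : a ≤ c_A * M ^ 4) (hcB : 0 ≤ c_B) (hC3e : 0 ≤ C3e) (hB : B = c_B * C3e)
    (h18 : C3e ≤ 2 * (L + 2) ^ 4 * c' * Real.exp (-(5 * κ)))
    (hκ : 2592 * K * (c₁ * c₂) * c' * c_B * (L + 2) ^ 4 * (1 / M ^ 4 + cr * c_A) * Real.exp (-(5 * κ)) <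
      (1 - ω) * E₀) :
    ω + K * (c₁ * α₄ / E₀) * B * ((1 + cr * a) * (c₂ * (6 * L) ^ 4)) < 1 := by
  have hB0 : 0 ≤ B := by rw [hB]; exact mul_nonneg hcB hC3e
  have h := rateGap_le_budget_AW hK hM hE hB0 hc₁ hc₂ hα₄ h20 hcr hcA ha
  have hX0 : 0 ≤ 1296 * K * (c₁ * c₂) * (1 / M ^ 4 + cr * c_A) := by positivity
  have hBE : B / E₀ ≤ c_B * (2 * (L + 2) ^ 4 * c' * Real.exp (-(5 * κ))) / E₀ := by
    rw [hB]; exact div_le_div_of_nonneg_right (mul_le_mul_of_nonneg_left h18 hcB) hE.le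
  have h2 := mul_le_mul_of_nonneg_left hBE hX0
  have h4 : 1296 * K * (c₁ * c₂) * (1 / M ^ 4 + cr * c_A) * (c_B * (2 * (L + 2) ^ 4 * c' * Real.exp (-(5 * κ))) / E₀)
      < 1 - ω := by
    rw [← mul_div_assoc, div_lt_iff₀ hE]; linarith
  linarith

/-- A SMALLER letter only helps: the (V1)-room at `ω′` implies the room at any `ω ≤ ω′`. [folklore] -/
theorem room_rate_anti {ω ω' K M c₁ c₂ cr c_A : ℝ} (hω : ω ≤ ω')
    (h : 648 * K * (c₁ * c₂) * (1 / M ^ 4 + cr * c_A) < 1 - ω') :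
    648 * K * (c₁ * c₂) * (1 / M ^ 4 + cr * c_A) < 1 - ω := by
  linarith

/-- … and likewise for the κ-clause (`E₀ ≥ 0`). [folklore] -/
theorem kappaClause_rate_anti {ω ω' T E₀ κ : ℝ} (hE : 0 ≤ E₀) (hω : ω ≤ ω')
    (h : T * Real.exp (-(5 * κ)) < (1 - ω') * E₀) : T * Real.exp (-(5 * κ)) < (1 - ω) * E₀ := by
  have : (1 - ω') * E₀ ≤ (1 - ω) * E₀ := mul_le_mul_of_nonneg_right (by linarith) hE
  linarith

/-- CONSISTENCY: PCB's (V1) `not_rescued_by_M` IS `not_rescued_by_M_rate` at `ω = 1/L`. [folklore] -/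
example {K L M c₁ c₂ cr c_A : ℝ} (hK : 0 ≤ K) (hM : 0 < M) (hc₁ : 0 ≤ c₁) (hc₂ : 0 ≤ c₂)
    (hroom : 648 * K * (c₁ * c₂) * (1 + cr * c_A * M ^ 4) < (1 - 1 / L) * M ^ 4) :
    648 * K * (c₁ * c₂) * (cr * c_A) < 1 - 1 / L :=
  not_rescued_by_M_rate hK hM hc₁ hc₂ hroom

end Rate

/-! ## §2 The Hölder instance `ω := L^{−β}` ([I] (4.18) p. 285 «0 ≦ β ≦ β₀ < 1», p. 288 «a positive β»; (0.30) p. 258) -/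

section Holder

/-- **THE HÖLDER LETTER IS THE HARDER INSTANCE**: for `1 ≤ L` and `β ≤ 1`, `1 − L^{−β} ≤ 1 − 1/L` (`gap_mono` + `rate_at_one` BY
NAME) — every PCB threshold certified at `ω = 1/L` is NECESSARY, not sufficient, at `ω = L^{−β}`. [cite: Balaban1987RG1, (4.18) p.285, p.288] -/
theorem gap_le_gap_one {L β : ℝ} (hL : 1 ≤ L) (hβ : β ≤ 1) : 1 - L ^ (-β) ≤ 1 - 1 / L := by
  have h := gap_mono hL hβ
  rwa [rate_at_one (by linarith : (0:ℝ) < L)] at h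

/-- **(V1) AT THE HÖLDER LETTER**: a room at `ω = L^{−β}` forces `648·K·c₁c₂·cr·c_A < 1 − L^{−β}` … [folklore] -/
theorem not_rescued_by_M_rpow {K L M β c₁ c₂ cr c_A : ℝ} (hK : 0 ≤ K) (hM : 0 < M) (hc₁ : 0 ≤ c₁) (hc₂ : 0 ≤ c₂)
    (hroom : 648 * K * (c₁ * c₂) * (1 + cr * c_A * M ^ 4) < (1 - L ^ (-β)) * M ^ 4) :
    648 * K * (c₁ * c₂) * (cr * c_A) < 1 - L ^ (-β) :=
  not_rescued_by_M_rate hK hM hc₁ hc₂ hroom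

/-- … hence (for `β ≤ 1`, `L ≥ 1`) ALSO PCB's (V1) bound `< 1 − 1/L`: the Hölder obstruction is the STRONGER one. [folklore] -/
theorem not_rescued_by_M_rpow_inv {K L M β c₁ c₂ cr c_A : ℝ} (hL : 1 ≤ L) (hβ : β ≤ 1) (hK : 0 ≤ K) (hM : 0 < M)
    (hc₁ : 0 ≤ c₁) (hc₂ : 0 ≤ c₂)
    (hroom : 648 * K * (c₁ * c₂) * (1 + cr * c_A * M ^ 4) < (1 - L ^ (-β)) * M ^ 4) :
    648 * K * (c₁ * c₂) * (cr * c_A) < 1 - 1 / L :=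
  (not_rescued_by_M_rpow hK hM hc₁ hc₂ hroom).trans_le (gap_le_gap_one hL hβ)

/-- **A ROOM AT `L^{−β}` BOUNDS THE EXPONENT FROM BELOW**: `648·K·c₁c₂·cr·c_A < β·log L` (`one_sub_rate_le` BY NAME:
`1 − L^{−β} ≤ β·log L`). [folklore] -/
theorem room_lt_exponent_mul_log {K L M β c₁ c₂ cr c_A : ℝ} (hL : 0 < L) (hK : 0 ≤ K) (hM : 0 < M) (hc₁ : 0 ≤ c₁)
    (hc₂ : 0 ≤ c₂) (hroom : 648 * K * (c₁ * c₂) * (1 + cr * c_A * M ^ 4) < (1 - L ^ (-β)) * M ^ 4) :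
    648 * K * (c₁ * c₂) * (cr * c_A) < β * Real.log L :=
  (not_rescued_by_M_rpow hK hM hc₁ hc₂ hroom).trans_le (one_sub_rate_le hL β)

/-- **THE EXPONENT FLOOR**: below `β = 648·K·c₁c₂·cr·c_A / log L` NO `M` satisfies the room at `ω = L^{−β′}` (`β′ ≤ β`, `L > 1`).
With the projection cost the «M sufficiently large» clause cannot be met AT ALL for small Hölder exponents — contrast (w6)'s M-only
clause, where small β merely enlarges `M` (`NE9FadingArithmeticHolder.room_not_uniform`). [folklore] -/
theorem no_M_below_floor {K L β c₁ c₂ cr c_A : ℝ} (hL : 1 < L) (hK : 0 ≤ K) (hc₁ : 0 ≤ c₁) (hc₂ : 0 ≤ c₂)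
    (hβ : β * Real.log L ≤ 648 * K * (c₁ * c₂) * (cr * c_A)) :
    ∀ M : ℝ, 0 < M → ¬ (648 * K * (c₁ * c₂) * (1 + cr * c_A * M ^ 4) < (1 - L ^ (-β)) * M ^ 4) :=
  fun _ hM hroom => absurd (room_lt_exponent_mul_log (by linarith) hK hM hc₁ hc₂ hroom) (not_lt.mpr hβ)

/-- **FOR EVERY POSITIVE PROJECTION COST THERE IS A POSITIVE EXPONENT WITH NO ADMISSIBLE `M`** — explicitly
`β := 648·K·c₁c₂·cr·c_A / log L` (`L > 1`). [folklore] -/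
theorem exists_exponent_no_M {K L c₁ c₂ cr c_A : ℝ} (hL : 1 < L) (hK : 0 ≤ K) (hc₁ : 0 ≤ c₁) (hc₂ : 0 ≤ c₂)
    (hX : 0 < 648 * K * (c₁ * c₂) * (cr * c_A)) :
    ∃ β : ℝ, 0 < β ∧ ∀ M : ℝ, 0 < M → ¬ (648 * K * (c₁ * c₂) * (1 + cr * c_A * M ^ 4) < (1 - L ^ (-β)) * M ^ 4) := by
  have hlog : 0 < Real.log L := Real.log_pos hL
  refine ⟨648 * K * (c₁ * c₂) * (cr * c_A) / Real.log L, div_pos hX hlog, no_M_below_floor hL hK hc₁ hc₂ (le_of_eq ?_)⟩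
  field_simp

/-- **(V2) AT THE HÖLDER LETTER**: `fade_of_p18_AW_rate` at `ω := L^{−β}` — κ-clause `… e^{−5κ} < (1 − L^{−β})·E₀`.
[cite: Balaban1987RG1, (4.18) p.285, p.288; Balaban1988RG2Cluster, p.18, p.20, p.21] -/
theorem fade_of_p18_AW_rpow {K L M β α₄ E₀ B c₁ c₂ cr a c_A c_B c' C3e κ : ℝ} (hK : 0 ≤ K) (hM : 0 < M) (hE : 0 < E₀)
    (hc₁ : 0 ≤ c₁) (hc₂ : 0 ≤ c₂) (hα₄ : 0 ≤ α₄) (h20 : (L * M) ^ 4 * α₄ ≤ 1) (hcr : 0 ≤ cr) (hcA : 0 ≤ c_A)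
    (ha : a ≤ c_A * M ^ 4) (hcB : 0 ≤ c_B) (hC3e : 0 ≤ C3e) (hB : B = c_B * C3e)
    (h18 : C3e ≤ 2 * (L + 2) ^ 4 * c' * Real.exp (-(5 * κ)))
    (hκ : 2592 * K * (c₁ * c₂) * c' * c_B * (L + 2) ^ 4 * (1 / M ^ 4 + cr * c_A) * Real.exp (-(5 * κ)) <
      (1 - L ^ (-β)) * E₀) :
    L ^ (-β) + K * (c₁ * α₄ / E₀) * B * ((1 + cr * a) * (c₂ * (6 * L) ^ 4)) < 1 :=
  fade_of_p18_AW_rate hK hM hE hc₁ hc₂ hα₄ h20 hcr hcA ha hcB hC3e hB h18 hκ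

/-- **UNIFORM FORM ON A DECLARED RANGE `β₁ ≤ β`** (`1 ≤ L`): the κ-clause at the LOWER end `β₁` gives fading at every `β ≥ β₁`
(`rate_antitone` BY NAME: `L^{−β} ≤ L^{−β₁}`). [cite: Balaban1987RG1, (4.18) p.285] -/
theorem fade_of_p18_AW_rpow_of_le {K L M β β₁ α₄ E₀ B c₁ c₂ cr a c_A c_B c' C3e κ : ℝ} (hL : 1 ≤ L) (hββ : β₁ ≤ β)
    (hK : 0 ≤ K) (hM : 0 < M) (hE : 0 < E₀) (hc₁ : 0 ≤ c₁) (hc₂ : 0 ≤ c₂) (hα₄ : 0 ≤ α₄) (h20 : (L * M) ^ 4 * α₄ ≤ 1)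
    (hcr : 0 ≤ cr) (hcA : 0 ≤ c_A) (ha : a ≤ c_A * M ^ 4) (hcB : 0 ≤ c_B) (hC3e : 0 ≤ C3e) (hB : B = c_B * C3e)
    (h18 : C3e ≤ 2 * (L + 2) ^ 4 * c' * Real.exp (-(5 * κ)))
    (hκ : 2592 * K * (c₁ * c₂) * c' * c_B * (L + 2) ^ 4 * (1 / M ^ 4 + cr * c_A) * Real.exp (-(5 * κ)) <
      (1 - L ^ (-β₁)) * E₀) :
    L ^ (-β) + K * (c₁ * α₄ / E₀) * B * ((1 + cr * a) * (c₂ * (6 * L) ^ 4)) < 1 :=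
  fade_of_p18_AW_rpow hK hM hE hc₁ hc₂ hα₄ h20 hcr hcA ha hcB hC3e hB h18
    (kappaClause_rate_anti hE.le (rate_antitone hL hββ) hκ)

end Holder

/-! ## §3 Numeric corners at `L = M = 13`, `K = 8`, `β = 1/4` (no letter of Bałaban's is valued; two engines, census v2 §6) -/

section Numeric

/-- **(V1) CEILING AT β = 1/4**: `89/979776 < (1 − 13^{−1/4})/(648·8) < 9/98496` (from `10/19 < 13^{−1/4} < 100/189`,
`NE9FadingArithmeticHolder.rpow13_neg_quarter_bounds`) — ≈ 9.1·10⁻⁵, against `1/5616 ≈ 1.78·10⁻⁴` at β = 1. [folklore] -/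
theorem ceiling_quarter_bounds :
    (89:ℝ) / 979776 < (1 - (13:ℝ) ^ (-(1/4:ℝ))) / (648 * 8) ∧ (1 - (13:ℝ) ^ (-(1/4:ℝ))) / (648 * 8) < 9 / 98496 := by
  obtain ⟨hlo, hhi⟩ := rpow13_neg_quarter_bounds
  constructor
  · rw [lt_div_iff₀ (by norm_num : (0:ℝ) < 648 * 8)]; linarith
  · rw [div_lt_iff₀ (by norm_num : (0:ℝ) < 648 * 8)]; linarith

/-- The β = 1/4 ceiling lies between 0.50 and 0.52 of the β = 1 ceiling `1/5616`: «roughly halves». [folklore] -/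
example : (1:ℝ) / 5616 * (50 / 100) < 89 / 979776 ∧ (9:ℝ) / 98496 < 1 / 5616 * (52 / 100) := by
  constructor <;> norm_num

/-- **DV-10's bite on (V1)**: the projection cost `cr·c_A = 10⁻⁴` (`c₁c₂ = 1`, `K = 8`, `L = 13`) is ADMISSIBLE at the old letter
`ω = 1/13` — `M = 13` satisfies the room … [folklore] -/
example : 648 * 8 * ((1:ℝ) * 1) * (1 + 1 * (1 / 10000) * (13:ℝ) ^ 4) < (1 - 1 / 13) * (13:ℝ) ^ 4 := by norm_num

/-- … but at the Hölder letter `ω = 13^{−1/4}` NO `M > 0` satisfies it (`no_M_of_rate_le`: `1 − 13^{−1/4} < 9/19 ≤ 5184·10⁻⁴`).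
[folklore] -/
example : ∀ M : ℝ, 0 < M →
    ¬ (648 * 8 * ((1:ℝ) * 1) * (1 + 1 * (1 / 10000) * M ^ 4) < (1 - (13:ℝ) ^ (-(1/4:ℝ))) * M ^ 4) := by
  refine no_M_of_rate_le (by norm_num) (by norm_num) (by norm_num) ?_
  have h := rpow13_neg_quarter_bounds.1
  linarith

/-- (V2) corner `K = 8`, `L = M = 13`, `c₁c₂ = c′ = c_B = E₀ = 1`, `cr·c_A = 1`: the κ-clause's numerator
`T″ = 2592·8·15⁴·(13⁻⁴ + 1) = 29983245120000/28561` (≈ 1.0498·10⁹; PCB's `T = T″/(1 − 1/13)`). [folklore] -/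
theorem T_corner_eq : 2592 * 8 * ((1:ℝ) * 1) * 1 * 1 * (13 + 2) ^ 4 * (1 / 13 ^ 4 + 1 * 1) = 29983245120000 / 28561 := by
  norm_num

/-- κ = 4 FAILS at β = 1/4 (it already failed at β = 1): `e^{20}·(1 − 13^{−1/4}) < e^{20}·(9/19) < T″` (`exp 1 < 2.72`). [folklore] -/
theorem kappa_four_fails_quarter : Real.exp (5 * 4) * (1 - (13:ℝ) ^ (-(1/4:ℝ))) < 29983245120000 / 28561 := by
  have h1 : Real.exp 1 < 272 / 100 := lt_trans Real.exp_one_lt_d9 (by norm_num)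
  have h20 : Real.exp (5 * 4) = Real.exp 1 ^ 20 := by rw [Real.exp_one_pow]; norm_num
  have hgap : 1 - (13:ℝ) ^ (-(1/4:ℝ)) < 9 / 19 := by have := rpow13_neg_quarter_bounds.1; linarith
  have hpow : Real.exp 1 ^ 20 < (272 / 100 : ℝ) ^ 20 := by gcongr
  have hE0 : 0 < Real.exp 1 ^ 20 := by positivity
  rw [h20]
  calc Real.exp 1 ^ 20 * (1 - (13:ℝ) ^ (-(1/4:ℝ))) < Real.exp 1 ^ 20 * (9 / 19) := by
        exact mul_lt_mul_of_pos_left hgap hE0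
    _ < (272 / 100 : ℝ) ^ 20 * (9 / 19) := by exact mul_lt_mul_of_pos_right hpow (by norm_num)
    _ < 29983245120000 / 28561 := by norm_num

/-- κ = 5 HOLDS at β = 1/4: `T″ < e^{25}·(89/189) < e^{25}·(1 − 13^{−1/4})` (`2.7 < exp 1`) — so **κ_min = 5 at β = 1/4, as at
β = 1** (PCB §3): the p. 18/«κ large» route is insensitive to the letter change at this corner. [folklore] -/
theorem kappa_five_holds_quarter : (29983245120000 : ℝ) / 28561 < Real.exp (5 * 5) * (1 - (13:ℝ) ^ (-(1/4:ℝ))) := by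
  have h1 : (27 : ℝ) / 10 < Real.exp 1 := lt_trans (by norm_num) Real.exp_one_gt_d9
  have h25 : Real.exp (5 * 5) = Real.exp 1 ^ 25 := by rw [Real.exp_one_pow]; norm_num
  have hgap : (89:ℝ) / 189 < 1 - (13:ℝ) ^ (-(1/4:ℝ)) := by have := rpow13_neg_quarter_bounds.2; linarith
  have hpow : (27 / 10 : ℝ) ^ 25 < Real.exp 1 ^ 25 := by gcongr
  have hE0 : 0 < Real.exp 1 ^ 25 := by positivity
  rw [h25]
  calc (29983245120000 : ℝ) / 28561 < (27 / 10 : ℝ) ^ 25 * (89 / 189) := by norm_num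
    _ < Real.exp 1 ^ 25 * (89 / 189) := by exact mul_lt_mul_of_pos_right hpow (by norm_num)
    _ < Real.exp 1 ^ 25 * (1 - (13:ℝ) ^ (-(1/4:ℝ))) := by exact mul_lt_mul_of_pos_left hgap hE0

/-- (V2) corner THROUGH THE THEOREM at β = 1/4: `fade_of_p18_AW_rpow`'s κ-clause at κ = 5 is met, so the corrected rate
`13^{−1/4} + 8·lipbar·B·((1 + a)·τ̄)` fades for every admissible α₄, M = 13, a ≤ M⁴ and every budget `B = C₃ε₁ ≤ 2·15⁴·e^{−25}`.
[folklore] -/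
example {α₄ B a C3e : ℝ} (hα₄ : 0 ≤ α₄) (h20 : (13 * 13 : ℝ) ^ 4 * α₄ ≤ 1) (ha : a ≤ 1 * (13 : ℝ) ^ 4) (hC3e : 0 ≤ C3e)
    (hB : B = 1 * C3e) (h18 : C3e ≤ 2 * (13 + 2) ^ 4 * 1 * Real.exp (-(5 * 5))) :
    (13:ℝ) ^ (-(1/4:ℝ)) + 8 * (1 * α₄ / 1) * B * ((1 + 1 * a) * (1 * (6 * 13) ^ 4)) < 1 := by
  refine fade_of_p18_AW_rpow (K := 8) (L := 13) (M := 13) (E₀ := 1) (c₁ := 1) (c₂ := 1) (cr := 1) (c_A := 1) (c_B := 1)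
    (c' := 1) (κ := 5) (by norm_num) (by norm_num) (by norm_num) (by norm_num) (by norm_num) hα₄ h20 (by norm_num)
    (by norm_num) ha (by norm_num) hC3e hB h18 ?_
  rw [kappaClause_iff, T_corner_eq, mul_comm ((1:ℝ) - _) 1, one_mul, mul_comm]
  exact kappa_five_holds_quarter

end Numeric

end Summit.QuantumFields.BalabanUV.T4Continuum.NE9ProjectionCostBudgetRate

end
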